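import Mathlib
import Literature.NumberTheory.LFunctions.MertensConjectureDisproofProofs
import HarnessLib

/-!
# Ingham's kernel theorem for Laplace transforms `ζ(1+2s) q(s)/ζ(½+s)` (Pólya's and Turán's sums)

Topic `Literature/NumberTheory/LFunctions` (trunk T-ANT). The analytic engine behind Haselgrove's
1958 disproof of the conjectures of Pólya and Turán, in the form printed by Borwein–Ferguson–
Mossinghoff, *Sign changes in sums of the Liouville function*, Math. Comp. 77 (2008), §1,
(3)–(7) p. 1683–1684 (after Ingham 1942): for `A(x) = e^{-x/2} L(e^x)` (Pólya's sum
`L(x) = Σ_{n≤x} λ(n)`) and `B(x) = e^{x/2} T(e^x)` (Turán's sum `T(x) = Σ_{n≤x} λ(n)/n`),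

  `liminf A ≤ A*_m(y) ≤ limsup A`,  `A*_m(y) = 1/ζ(½) + 2 Re Σ_{0<γ_n<m} k(γ_n) ζ(2ρ_n)/(ρ_n ζ'(ρ_n)) e^{iγ_n y}` (4)–(5),
  `liminf B ≤ B*_m(y) ≤ limsup B`,  `B*_m(y) = -1/ζ(½) + 2 Re Σ_{0<γ_n<m} k(γ_n) ζ(2ρ_n)/((ρ_n-1) ζ'(ρ_n)) e^{iγ_n y}` (7),

printed with the Fejér weight `k(γ) = 1 - γ/m` and proved here for an arbitrary admissible kernel
(Odlyzko–te Riele's form, as in the tree's `OdlyzkoTeRiele1985_kernelTheorem_holds`,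
`MertensConjectureDisproofProofs.lean`, whose proof is followed line by line).

Both are instances of ONE statement, proved here in the abstract (`zetaQuot_frequently_gt_and_lt`):
let `f` be real, measurable, vanishing on `(-∞,0)`, locally bounded, and suppose that every
one-sided bound on `f` makes `f(u)e^{-σu}` integrable (`σ > 0`) with Laplace transform
`ζ(1+2s) q(s)/ζ(½+s)` on `0 < Re s < ½`, for a fixed `q` holomorphic on the strip
`-¼ < Re s < ½` (for `A`: `q(s) = 1/(½+s)`, BFM (3)–(4) via `F(w) = ζ(2w)/ζ(w)`, (1); for `B`:
`q(s) = 1/(s-½)`). If the zeros `β+iγ` of `ζ` with `0 < β < 1`, `|γ| < T` are simple and on the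
line, then for every admissible kernel `K` (transform `k` supported in `[-T,T]`, `k(0) = 1`) and
every `y₀`, `f(y) > Re S(y₀) - ε` and `f(y) < Re S(y₀) + ε` for arbitrarily large `y`, where

  `S(y) = q(0)/(2ζ(½)) + Σ_{|γ|<T} k(γ) e^{iγy} ζ(2ρ) q(ρ-½)/ζ'(ρ)`   (`zetaQuotInghamSum`)

— the pole of `ζ(1+2s)` at `s = 0` contributes the constant term (residue `q(0)/(2ζ(½))`, i.e.
`±1/ζ(½)` in (4), (7)), and each zero `ρ = ½+iγ` the polar part with residue `ζ(2ρ)q(ρ-½)/ζ'(ρ)`.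

## Main results (all proved, sorry-free)

* `exists_regularPart_zetaQuot` — the regular part: `ζ(1+2s)q(s)/ζ(½+s)` minus its polar parts at
  `0` and at the `iγ` has a continuous modification on `[0,¼] × [-T',T']` (`T' < T`); the pole at
  `0` is handled with Mathlib's `tendsto_riemannZeta_sub_one_div` (`ζ(s) - 1/(s-1) → γ`).
* `zetaQuot_frequently_gt_and_lt` — the abstract kernel theorem above (dilation trick `K(y/c)/c`,
  `c → 1⁺`, exactly as in `OdlyzkoTeRiele1985_kernelTheorem_holds`).

The instances for `L` and `T` (with the number-theoretic input, Landau's theorem, from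
`LiouvilleOneSided.lean` / `TuranOneSided.lean`) are in `LiouvilleKernelTheorem.lean`.

## References

* [BorweinFergusonMossinghoff2008] P. Borwein, R. Ferguson, M. J. Mossinghoff, *Sign changes in
  sums of the Liouville function*, Math. Comp. 77 (2008), 1681–1694: §1, (3)–(7), pp. 1683–1684.
* [Ingham1942] A. E. Ingham, *On two conjectures in the theory of numbers*, Amer. J. Math. 64
  (1942), 313–319 (Theorem 1 and Theorem A).
* [OdlyzkoTeRiele1985] A. M. Odlyzko, H. J. J. te Riele, *Disproof of the Mertens conjecture*,
  J. reine angew. Math. 357 (1985), §2 Theorem p. 144 (the kernel form).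
* [BatemanDiamond2004] P. T. Bateman, H. G. Diamond, *Analytic Number Theory*, Thm. 11.12.
-/

noncomputable section

open Complex Filter Asymptotics MeasureTheory Set
open scoped Real Topology

namespace Literature.NumberTheory.LFunctions

/-! ## The objects -/

/-- `ζ(s) - 1/(s-1)` with the removable singularity at `s = 1` filled in by its limit, Euler's
constant (Mathlib's `tendsto_riemannZeta_sub_one_div`). [folklore] -/
def zetaMinusPole : ℂ → ℂ :=
  Function.update (fun s ↦ riemannZeta s - 1 / (s - 1)) 1 (Real.eulerMascheroniConstant : ℂ)

/-- Off `s = 1`, `zetaMinusPole s = ζ(s) - 1/(s-1)`. [folklore] -/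
theorem zetaMinusPole_of_ne_one {s : ℂ} (hs : s ≠ 1) :
    zetaMinusPole s = riemannZeta s - 1 / (s - 1) := by
  unfold zetaMinusPole
  rw [Function.update_of_ne hs]

/-- `zetaMinusPole` is continuous at `1` (`ζ(s) - 1/(s-1) → γ`, Mathlib). [folklore] -/
theorem continuousAt_zetaMinusPole_one : ContinuousAt zetaMinusPole 1 := by
  unfold zetaMinusPole
  exact continuousAt_update_same.2 tendsto_riemannZeta_sub_one_div

/-- The finite trigonometric sum of the kernel theorem for a Laplace transform
`ζ(1+2s) q(s)/ζ(½+s)`: `S(y) = q(0)/(2ζ(½)) + Σ_{ρ : 0<β<1, |γ|<T} k(γ) e^{iγy} ζ(2ρ) q(ρ-½)/ζ'(ρ)`.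
For `q(s) = 1/(½+s)` this is `A*` of BFM (4) (constant term `1/ζ(½)`, coefficients
`ζ(2ρ)/(ρζ'(ρ))`), for `q(s) = 1/(s-½)` it is `B*` of BFM (7) (constant term `-1/ζ(½)`,
coefficients `ζ(2ρ)/((ρ-1)ζ'(ρ))`), both for a general weight `k` in place of `1 - γ/m`.
[cite: BorweinFergusonMossinghoff2008, §1 (4) and (7) pp. 1683–1684] -/
def zetaQuotInghamSum (q : ℂ → ℂ) (k : ℝ → ℂ) (T y : ℝ) : ℂ :=
  q 0 / (2 * riemannZeta (1 / 2)) +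
    ∑ ρ ∈ (zetaZerosBelow_finite T).toFinset,
      k ρ.im * cexp (I * (ρ.im * y)) * (riemannZeta (2 * ρ) * q (ρ - 1 / 2) / deriv riemannZeta ρ)

/-- `ζ(½) ≠ 0` (indeed `ζ(½) < 0`, `ZetaRealAxis.lean`). [folklore] -/
theorem riemannZeta_one_half_ne_zero : riemannZeta (1 / 2) ≠ 0 := by
  have h := riemannZeta_neg_of_pos_of_lt_one (σ := 1 / 2) (by norm_num) (by norm_num)
  have h' : ((1 / 2 : ℝ) : ℂ) = 1 / 2 := by push_cast; ring
  rw [h'] at h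
  intro h0
  rw [h0] at h
  simp at h

/-- `½` is not in the index set of zeros (`ζ(½) ≠ 0`). [folklore] -/
theorem one_half_not_mem_zetaZerosBelow (T : ℝ) :
    (1 / 2 : ℂ) ∉ (zetaZerosBelow_finite T).toFinset := by
  rw [mem_zetaZerosBelow_toFinset]
  exact fun h ↦ riemannZeta_one_half_ne_zero h.1

section RegularPart

variable {T : ℝ} {q : ℂ → ℂ}

/-- Under the zero hypothesis every `ρ` in the index set has `ρ.im ≠ 0` (`ζ(½) ≠ 0`). [folklore] -/
theorem im_ne_zero_of_mem_zetaZerosBelow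
    (hz : ∀ ρ : ℂ, riemannZeta ρ = 0 → 0 < ρ.re → ρ.re < 1 → |ρ.im| < T →
      ρ.re = 1 / 2 ∧ deriv riemannZeta ρ ≠ 0)
    {ρ : ℂ} (hρ : ρ ∈ (zetaZerosBelow_finite T).toFinset) : ρ.im ≠ 0 := by
  obtain ⟨h0, -, hρeq, -⟩ := zetaZerosBelow_spec hz hρ
  intro him
  rw [him] at hρeq
  simp only [Complex.ofReal_zero, zero_mul, add_zero] at hρeq
  rw [hρeq] at h0
  exact riemannZeta_one_half_ne_zero h0

/-- The open strip `-¼ < Re z < ½` on which `q` is assumed holomorphic. [folklore] -/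
def qStrip : Set ℂ := {z : ℂ | -(1 / 4 : ℝ) < z.re ∧ z.re < 1 / 2}

/-- The strip is open. [folklore] -/
theorem isOpen_qStrip : IsOpen qStrip :=
  (isOpen_lt continuous_const Complex.continuous_re).inter
    (isOpen_lt Complex.continuous_re continuous_const)

/-- "Good" points: not `0`, not a pole `iγ`, `ζ(½+z) ≠ 0`, `½ + z ≠ 1`, and `q` continuous. At a
good point `ζ(1+2z)q(z)/ζ(½+z) - c₀/z - Σ a_ρ/(z - iγ)` is continuous. [folklore] -/
theorem continuousAt_zetaQuot_sub_polar {z : ℂ} (c₀ : ℂ) (a : ℂ → ℂ)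
    (hp : ∀ ρ ∈ (zetaZerosBelow_finite T).toFinset, z ≠ ρ.im * I) (hz0 : z ≠ 0)
    (hζ : riemannZeta (1 / 2 + z) ≠ 0) (h1 : 1 / 2 + z ≠ 1) (hq : ContinuousAt q z) :
    ContinuousAt (fun w : ℂ ↦ riemannZeta (1 + 2 * w) * q w / riemannZeta (1 / 2 + w) - c₀ / w -
      ∑ ρ ∈ (zetaZerosBelow_finite T).toFinset, a ρ / (w - ρ.im * I)) z := by
  refine ContinuousAt.sub (ContinuousAt.sub ?_ ?_) ?_
  · have h2 : 1 + 2 * z ≠ 1 := by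
      intro h; apply hz0
      have : 2 * z = 0 := by linear_combination h
      simpa using this
    have hin : ContinuousAt (fun w : ℂ ↦ 1 + 2 * w) z := by fun_prop
    have hc1 : ContinuousAt (fun w : ℂ ↦ riemannZeta (1 + 2 * w)) z :=
      ContinuousAt.comp (f := fun w : ℂ ↦ 1 + 2 * w) (g := riemannZeta)
        (differentiableAt_riemannZeta h2).continuousAt hin
    have hc2 : ContinuousAt (fun w : ℂ ↦ riemannZeta (1 / 2 + w)) z :=
      (differentiableAt_riemannZeta h1).continuousAt.comp (continuous_const.add continuous_id).continuousAt
    exact (hc1.mul hq).div hc2 hζ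
  · exact continuousAt_const.div continuousAt_id hz0
  · refine tendsto_finsetSum _ fun ρ hρ ↦ ?_
    refine ContinuousAt.div continuousAt_const (continuousAt_id.sub continuousAt_const) ?_
    exact sub_ne_zero.2 (hp ρ hρ)

/-- Near any point of the closed box `0 ≤ Re s ≤ ¼`, `|Im s| ≤ T'` (`T' < T`), all points of a
punctured neighbourhood are good (in particular `≠ 0` and in the strip). [folklore] -/
theorem eventually_good'
    (hz : ∀ ρ : ℂ, riemannZeta ρ = 0 → 0 < ρ.re → ρ.re < 1 → |ρ.im| < T →
      ρ.re = 1 / 2 ∧ deriv riemannZeta ρ ≠ 0)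
    {T' : ℝ} (hT'T : T' < T) {s : ℂ} (hs : s ∈ Set.Icc (0 : ℝ) (1 / 4) ×ℂ Set.Icc (-T') T') :
    ∀ᶠ z in 𝓝[≠] s, (∀ ρ ∈ (zetaZerosBelow_finite T).toFinset, z ≠ ρ.im * I) ∧
      riemannZeta (1 / 2 + z) ≠ 0 ∧ (1 / 2 + z ≠ 1) ∧ (1 / 2 + z ≠ 0) ∧ z ≠ 0 ∧ z ∈ qStrip := by
  have hev := eventually_good hz hT'T hs
  rw [Complex.mem_reProdIm] at hs
  obtain ⟨⟨hs1, hs2⟩, -, -⟩ := hs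
  have hstrip : ∀ᶠ z in 𝓝 s, z ∈ qStrip :=
    isOpen_qStrip.mem_nhds ⟨by linarith, by linarith⟩
  have hne0 : ∀ᶠ z in 𝓝[≠] s, z ≠ (0 : ℂ) := by
    by_cases hs0 : s = 0
    · rw [hs0]; exact self_mem_nhdsWithin
    · exact mem_nhdsWithin_of_mem_nhds (isOpen_compl_singleton.mem_nhds hs0)
  filter_upwards [hev, hne0, mem_nhdsWithin_of_mem_nhds hstrip] with z h1 h2 h3
  exact ⟨h1.1, h1.2.1, h1.2.2.1, h1.2.2.2, h2, h3⟩

/-- **Local structure at a simple zero**: if `ρ₀` is a zero of `ζ`, then for any numerator `N`,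
`N(z)/ζ(½+z) - (N(s₀)/ζ'(ρ₀))/(z - s₀) = dslope φ s₀ z` off `s₀ = ρ₀ - ½`, with
`φ(w) = N(w)/dslope ζ ρ₀ (½+w)` (so the singularity at `s₀` is removable when `ζ'(ρ₀) ≠ 0`).
[cite: BatemanDiamond2004, Theorem 11.12 and Remarks 11.13] -/
theorem quot_sub_polar_eq_dslope (N : ℂ → ℂ) {ρ₀ : ℂ} (hζ0 : riemannZeta ρ₀ = 0) {z : ℂ}
    (hz : z ≠ ρ₀ - 1 / 2) :
    N z / riemannZeta (1 / 2 + z) - N (ρ₀ - 1 / 2) / deriv riemannZeta ρ₀ / (z - (ρ₀ - 1 / 2)) =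
      dslope (fun w : ℂ ↦ N w / dslope riemannZeta ρ₀ (1 / 2 + w)) (ρ₀ - 1 / 2) z := by
  have hfac : riemannZeta (1 / 2 + z) = (z - (ρ₀ - 1 / 2)) * dslope riemannZeta ρ₀ (1 / 2 + z) := by
    have h := sub_smul_dslope riemannZeta ρ₀ (1 / 2 + z)
    rw [hζ0, sub_zero, smul_eq_mul] at h
    rw [← h]; congr 1; ring
  rw [dslope_of_ne _ hz, slope_def_field]
  have hρ : (1 / 2 : ℂ) + (ρ₀ - 1 / 2) = ρ₀ := by ring
  rw [hρ, dslope_same, hfac]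
  have hne : z - (ρ₀ - 1 / 2) ≠ 0 := sub_ne_zero.2 hz
  field_simp

/-- **Local structure at the pole `s = 0` of `ζ(1+2s)`**: off `0` (and where `ζ(½+z) ≠ 0`),
`ζ(1+2z)q(z)/ζ(½+z) - (q(0)/(2ζ(½)))/z = (ζ(1+2z) - 1/(2z)) r(z) + ½ dslope r 0 z` with
`r(w) = q(w)/ζ(½+w)` — the right-hand side is continuous at `0` (Euler's constant fills the first
factor). [folklore] -/
theorem zetaQuot_sub_polar_zero_eq {z : ℂ} (hz0 : z ≠ 0) :
    riemannZeta (1 + 2 * z) * q z / riemannZeta (1 / 2 + z) -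
        q 0 / (2 * riemannZeta (1 / 2)) / z =
      zetaMinusPole (1 + 2 * z) * (q z / riemannZeta (1 / 2 + z)) +
        1 / 2 * dslope (fun w : ℂ ↦ q w / riemannZeta (1 / 2 + w)) 0 z := by
  have h2 : 1 + 2 * z ≠ 1 := by
    intro h; apply hz0
    have : 2 * z = 0 := by linear_combination h
    simpa using this
  rw [zetaMinusPole_of_ne_one h2, dslope_of_ne _ hz0, slope_def_field]
  simp only [sub_zero, add_zero]
  have hζh : riemannZeta (1 / 2) ≠ 0 := riemannZeta_one_half_ne_zero
  have h2z : (1 + 2 * z - 1) = 2 * z := by ring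
  rw [h2z]
  have h2z0 : (2 : ℂ) * z ≠ 0 := mul_ne_zero two_ne_zero hz0
  field_simp
  ring

/-- **The regular part** (existence of `R` in the hypothesis `SmoothingData.laplace_eq`): if the
zeros of `ζ` with `0 < β < 1`, `|γ| < T` are simple and on the line, `q` is holomorphic on the
strip `-¼ < Re s < ½`, and `T' < T`, there is `R` continuous on the closed rectangle
`[0, ¼] × [-T', T']` with
`ζ(1+2s)q(s)/ζ(½+s) = (q(0)/(2ζ(½)))/s + Σ_{|γ|<T} (ζ(2ρ)q(ρ-½)/ζ'(ρ))/(s - iγ) + R(s)` for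
`0 < Re s ≤ ¼`, `|Im s| ≤ T'` (Bateman–Diamond Thm. 11.12: "`G - G*` has a continuation as a
continuous function on the closed strip"). [cite: BatemanDiamond2004, Theorem 11.12 (hypothesis on `G - G*`)] -/
theorem exists_regularPart_zetaQuot (hq : DifferentiableOn ℂ q qStrip)
    (hz : ∀ ρ : ℂ, riemannZeta ρ = 0 → 0 < ρ.re → ρ.re < 1 → |ρ.im| < T →
      ρ.re = 1 / 2 ∧ deriv riemannZeta ρ ≠ 0)
    {T' : ℝ} (hT'T : T' < T) :
    ∃ R : ℂ → ℂ, ContinuousOn R (Set.Icc (0 : ℝ) (1 / 4) ×ℂ Set.Icc (-T') T') ∧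
      ∀ σ t : ℝ, 0 < σ → σ ≤ 1 / 4 → |t| ≤ T' →
        riemannZeta (1 + 2 * ((σ : ℂ) + t * I)) * q ((σ : ℂ) + t * I) /
            riemannZeta (1 / 2 + ((σ : ℂ) + t * I)) =
          q 0 / (2 * riemannZeta (1 / 2)) / ((σ : ℂ) + t * I) +
          ∑ ρ ∈ (zetaZerosBelow_finite T).toFinset,
            riemannZeta (2 * ρ) * q (ρ - 1 / 2) / deriv riemannZeta ρ / ((σ : ℂ) + t * I - ρ.im * I) +
          R (σ + t * I) := by
  set P := (zetaZerosBelow_finite T).toFinset with hP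
  set c₀ : ℂ := q 0 / (2 * riemannZeta (1 / 2)) with hc₀
  set a : ℂ → ℂ := fun ρ ↦ riemannZeta (2 * ρ) * q (ρ - 1 / 2) / deriv riemannZeta ρ with ha
  set Z : ℂ → ℂ := fun w ↦ riemannZeta (1 + 2 * w) * q w / riemannZeta (1 / 2 + w) with hZ
  set g : ℂ → ℂ := fun w ↦ Z w - c₀ / w - ∑ ρ ∈ P, a ρ / (w - ρ.im * I) with hg
  have hqc : ∀ z ∈ qStrip, ContinuousAt q z := fun z hz ↦
    ((hq z hz).differentiableAt (isOpen_qStrip.mem_nhds hz)).continuousAt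
  have hqd : ∀ z ∈ qStrip, DifferentiableAt ℂ q z := fun z hz ↦
    (hq z hz).differentiableAt (isOpen_qStrip.mem_nhds hz)
  -- continuity of `g` at good points
  have hgood_cont : ∀ z : ℂ, (∀ ρ ∈ P, z ≠ ρ.im * I) → riemannZeta (1 / 2 + z) ≠ 0 →
      (1 / 2 + z ≠ 1) → z ≠ 0 → z ∈ qStrip → ContinuousAt g z := by
    intro z hpz hζz h1z hz0 hzs
    exact continuousAt_zetaQuot_sub_polar c₀ a hpz hz0 hζz h1z (hqc z hzs)
  have hmod : ∀ s ∈ Set.Icc (0 : ℝ) (1 / 4) ×ℂ Set.Icc (-T') T',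
      ∃ ψ : ℂ → ℂ, ContinuousAt ψ s ∧ ∀ᶠ z in 𝓝[≠] s, g z = ψ z ∧ ContinuousAt g z := by
    intro s hs
    have hev := eventually_good' hz hT'T hs
    have hs_strip : s ∈ qStrip := by
      rw [Complex.mem_reProdIm] at hs
      exact ⟨by linarith [hs.1.1], by linarith [hs.1.2]⟩
    by_cases hs0 : s = 0
    · -- the pole of `ζ(1+2s)` at `0`
      subst hs0
      set r : ℂ → ℂ := fun w ↦ q w / riemannZeta (1 / 2 + w) with hr
      set ψ : ℂ → ℂ := fun w ↦ zetaMinusPole (1 + 2 * w) * r w + 1 / 2 * dslope r 0 w -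
        ∑ ρ ∈ P, a ρ / (w - ρ.im * I) with hψ
      have hr_d : DifferentiableAt ℂ r 0 := by
        refine (hqd 0 hs_strip).div ?_ ?_
        · exact (differentiableAt_riemannZeta (by norm_num)).comp (0 : ℂ)
            ((differentiableAt_const _).add differentiableAt_id)
        · simpa using riemannZeta_one_half_ne_zero
      refine ⟨ψ, ?_, ?_⟩
      · refine ContinuousAt.sub (ContinuousAt.add ?_ ?_) ?_
        · refine ContinuousAt.mul ?_ hr_d.continuousAt
          have h1 : ContinuousAt (fun w : ℂ ↦ 1 + 2 * w) 0 :=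
            (continuous_const.add (continuous_const.mul continuous_id)).continuousAt
          have h2 : ContinuousAt zetaMinusPole ((fun w : ℂ ↦ 1 + 2 * w) 0) := by
            simpa using continuousAt_zetaMinusPole_one
          exact ContinuousAt.comp h2 h1
        · exact continuousAt_const.mul (continuousAt_dslope_same.2 hr_d)
        · refine tendsto_finsetSum _ fun ρ hρ ↦ ?_
          refine ContinuousAt.div continuousAt_const (continuousAt_id.sub continuousAt_const) ?_
          rw [zero_sub, neg_ne_zero]
          have := im_ne_zero_of_mem_zetaZerosBelow hz hρ
          intro h
          apply this
          have := congrArg Complex.im h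
          simpa using this
      · filter_upwards [hev] with z hgood
        obtain ⟨hpz, hζz, h1z, -, hz0, hzs⟩ := hgood
        refine ⟨?_, hgood_cont z hpz hζz h1z hz0 hzs⟩
        simp only [hg, hψ, hZ]
        rw [zetaQuot_sub_polar_zero_eq hz0]
    by_cases hpole : ∃ ρ₀ ∈ P, s = ρ₀.im * I
    · -- a pole at a zero
      obtain ⟨ρ₀, hρ₀, rfl⟩ := hpole
      obtain ⟨hζ0, hd0, hρeq, -⟩ := zetaZerosBelow_spec hz hρ₀
      have hρ1 : ρ₀ ≠ 1 := by
        intro h; rw [h] at hζ0; exact riemannZeta_one_ne_zero hζ0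
      have hs0' : (ρ₀.im : ℂ) * I = ρ₀ - 1 / 2 := by
        conv_rhs => rw [hρeq]
        ring
      set N : ℂ → ℂ := fun w ↦ riemannZeta (1 + 2 * w) * q w with hN
      set φ : ℂ → ℂ := fun w ↦ N w / dslope riemannZeta ρ₀ (1 / 2 + w) with hφ
      set ψ : ℂ → ℂ := fun w ↦ dslope φ (ρ₀ - 1 / 2) w - c₀ / w -
        ∑ ρ ∈ P.erase ρ₀, a ρ / (w - ρ.im * I) with hψ
      have haρ₀ : a ρ₀ = N (ρ₀ - 1 / 2) / deriv riemannZeta ρ₀ := by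
        simp only [ha, hN]
        congr 2; ring
      refine ⟨ψ, ?_, ?_⟩
      · -- continuity of `ψ` at the pole
        refine ContinuousAt.sub (ContinuousAt.sub ?_ ?_) ?_
        · rw [hs0']
          refine continuousAt_dslope_same.2 ?_
          have hζd : DifferentiableOn ℂ riemannZeta {(1 : ℂ)}ᶜ := fun w hw ↦
            (differentiableAt_riemannZeta hw).differentiableWithinAt
          have hζa : AnalyticAt ℂ riemannZeta ρ₀ :=
            hζd.analyticAt (isOpen_compl_singleton.mem_nhds hρ1)
          have hda : AnalyticAt ℂ (dslope riemannZeta ρ₀) ρ₀ := by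
            obtain ⟨p, hp⟩ := hζa
            exact ⟨_, hp.has_fpower_series_dslope_fslope⟩
          have hρ : (1 / 2 : ℂ) + (ρ₀ - 1 / 2) = ρ₀ := by ring
          have hd1 : DifferentiableAt ℂ (dslope riemannZeta ρ₀) (1 / 2 + (ρ₀ - 1 / 2)) := by
            rw [hρ]; exact hda.differentiableAt
          have hinner : DifferentiableAt ℂ (fun w : ℂ ↦ 1 / 2 + w) (ρ₀ - 1 / 2) :=
            (differentiableAt_const _).add differentiableAt_id
          have hd2 : DifferentiableAt ℂ (fun w : ℂ ↦ dslope riemannZeta ρ₀ (1 / 2 + w)) (ρ₀ - 1 / 2) :=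
            hd1.comp (ρ₀ - 1 / 2) hinner
          have hD0 : dslope riemannZeta ρ₀ (1 / 2 + (ρ₀ - 1 / 2)) ≠ 0 := by
            rw [hρ, dslope_same]; exact hd0
          -- `N` is differentiable at `s₀`
          have h2s : 1 + 2 * (ρ₀ - 1 / 2) ≠ 1 := by
            rw [← hs0']
            intro h
            have := congrArg Complex.im h
            simp at this
            exact im_ne_zero_of_mem_zetaZerosBelow hz hρ₀ this
          have hN1 : DifferentiableAt ℂ (fun w : ℂ ↦ riemannZeta (1 + 2 * w)) (ρ₀ - 1 / 2) :=
            (differentiableAt_riemannZeta h2s).comp (ρ₀ - 1 / 2)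
              ((differentiableAt_const _).add ((differentiableAt_const _).mul differentiableAt_id))
          have hNd : DifferentiableAt ℂ N (ρ₀ - 1 / 2) := by
            refine hN1.mul (hqd _ ?_)
            rw [← hs0']; exact hs_strip
          exact hNd.div hd2 hD0
        · refine continuousAt_const.div continuousAt_id ?_
          rw [hs0'] at hs0 ⊢
          exact hs0
        · refine tendsto_finsetSum _ fun ρ hρ ↦ ?_
          refine ContinuousAt.div continuousAt_const (continuousAt_id.sub continuousAt_const) ?_
          rw [Finset.mem_erase] at hρ
          intro heq
          apply hρ.1
          have h2 := (zetaZerosBelow_spec hz hρ.2).2.2.1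
          have him : ρ₀.im = ρ.im := by
            have := congrArg Complex.im (sub_eq_zero.1 heq)
            simpa using this
          rw [h2, hρeq, him]
      · filter_upwards [hev, self_mem_nhdsWithin] with z hgood hzs
        obtain ⟨hpz, hζz, h1z, -, hz0', hzstrip⟩ := hgood
        refine ⟨?_, hgood_cont z hpz hζz h1z hz0' hzstrip⟩
        simp only [hg, hψ, hZ]
        rw [← Finset.add_sum_erase P _ hρ₀, haρ₀, hs0',
          ← quot_sub_polar_eq_dslope N hζ0 (by rwa [← hs0'])]
        ring
    · refine ⟨g, ?_, ?_⟩
      · have hgood : (∀ ρ ∈ P, s ≠ ρ.im * I) := fun ρ hρ h ↦ hpole ⟨ρ, hρ, h⟩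
        rw [Complex.mem_reProdIm] at hs
        obtain ⟨⟨hs1, hs2⟩, hs3, hs4⟩ := hs
        have hb := good_of_mem_box hz (z := s) (by linarith) (by linarith)
          (lt_of_le_of_lt (abs_le.2 ⟨hs3, hs4⟩) hT'T) hgood
        exact hgood_cont s hgood hb.1 hb.2.1 hs0 hs_strip
      · filter_upwards [hev] with z hgood
        obtain ⟨hpz, hζz, h1z, -, hz0', hzstrip⟩ := hgood
        exact ⟨rfl, hgood_cont z hpz hζz h1z hz0' hzstrip⟩
  obtain ⟨R, hRc, hRg⟩ := exists_continuousOn_modification hmod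
  refine ⟨R, hRc, fun σ t hσ hσ' ht ↦ ?_⟩
  have hgood : ∀ ρ ∈ P, (σ : ℂ) + t * I ≠ ρ.im * I := by
    intro ρ _ h
    have := congrArg Complex.re h; simp at this; linarith
  have hst0 : (σ : ℂ) + t * I ≠ 0 := by
    intro h; have := congrArg Complex.re h; simp at this; linarith
  have hstrip : (σ : ℂ) + t * I ∈ qStrip := ⟨by simp; linarith, by simp; linarith⟩
  have hb := good_of_mem_box hz (z := (σ : ℂ) + t * I) (by simp; linarith) (by simp; linarith)
    (by simpa using lt_of_le_of_lt ht hT'T) hgood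
  have hcont := hgood_cont _ hgood hb.1 hb.2.1 hst0 hstrip
  rw [hRg _ hcont]
  simp only [hg]
  ring

end RegularPart

/-! ## The kernel theorem, abstract form -/

/-- **Ingham's kernel theorem for Laplace transforms `ζ(1+2s)q(s)/ζ(½+s)`** (the common content of
BFM 2008 (5) for `A` and its analogue for `B`, p. 1684: "inequalities analogous to those in (5)
hold for the functions `B(x)` and `B*_m(x)`", in Odlyzko–te Riele's admissible-kernel form): let
`f` be real, measurable, vanishing on `(-∞,0)`, locally bounded, such that each one-sided bound on
`f` makes `f(u)e^{-σu}` integrable for `σ > 0` with Laplace transform `ζ(1+2s)q(s)/ζ(½+s)` on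
`0 < Re s < ½`, where `q` is holomorphic on `-¼ < Re s < ½`; let `K` be an admissible kernel
(`C²`, `≥ 0`, even, `O((1+y²)⁻¹)`, transform vanishing for `|t| ≥ T`, `k(0) = 1`), and suppose the
zeros `β+iγ` of `ζ` with `0 < β < 1`, `|γ| < T` are simple and on the line. Then for every `y₀` and
every `b < Re S(y₀)` (resp. `b > Re S(y₀)`), `f(y) > b` (resp. `f(y) < b`) for arbitrarily large
`y`, `S = zetaQuotInghamSum q k T`. Proof exactly as `OdlyzkoTeRiele1985_kernelTheorem_holds`
(abstract oscillation theorem for the dilated kernel `K(y/c)/c`, `c → 1⁺`), with the index set of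
polar parts `{½} ∪ {ρ}` (`γ(½) = 0` carrying the pole of `ζ(1+2s)` at `s = 0`).
[cite: BorweinFergusonMossinghoff2008, §1 (5) p. 1683 and p. 1684; OdlyzkoTeRiele1985, §2 Theorem p. 144] -/
theorem zetaQuot_frequently_gt_and_lt {f : ℝ → ℝ} {q : ℂ → ℂ}
    (hfm : Measurable f) (hf0 : ∀ u, u < 0 → f u = 0) (hfloc : ∀ b, ∃ B, ∀ u, u ≤ b → |f u| ≤ B)
    (hq : DifferentiableOn ℂ q qStrip)
    (hL : ∀ a : ℝ, ((∀ u, f u ≤ a) ∨ (∀ u, -a ≤ f u)) →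
      (∀ σ : ℝ, 0 < σ → Integrable (fun u ↦ f u * Real.exp (-(σ * u)))) ∧
      ∀ σ t : ℝ, 0 < σ → σ < 1 / 2 →
        ∫ u : ℝ, (f u : ℂ) * cexp (-(((σ : ℂ) + t * I) * u)) =
          riemannZeta (1 + 2 * ((σ : ℂ) + t * I)) * q ((σ : ℂ) + t * I) /
            riemannZeta (1 / 2 + ((σ : ℂ) + t * I)))
    (K : ℝ → ℝ) (T : ℝ) (hK2 : ContDiff ℝ 2 K) (hKnn : ∀ y : ℝ, 0 ≤ K y)
    (hKev : ∀ y : ℝ, K (-y) = K y) (hKO : K =O[atTop] fun y : ℝ ↦ (1 + y ^ 2)⁻¹)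
    (hkz : ∀ t : ℝ, T ≤ |t| → kernelTransform K t = 0) (hk0 : kernelTransform K 0 = 1)
    (hzeros : ∀ ρ : ℂ, riemannZeta ρ = 0 → 0 < ρ.re → ρ.re < 1 → |ρ.im| < T →
      ρ.re = 1 / 2 ∧ deriv riemannZeta ρ ≠ 0)
    (y₀ : ℝ) :
    (∀ b : ℝ, b < (zetaQuotInghamSum q (kernelTransform K) T y₀).re → ∃ᶠ y in atTop, b < f y) ∧
    (∀ b : ℝ, (zetaQuotInghamSum q (kernelTransform K) T y₀).re < b → ∃ᶠ y in atTop, f y < b) := by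
  classical
  -- `T > 0`
  have hT : 0 < T := by
    by_contra h
    push Not at h
    have := hkz 0 (by simpa using h)
    rw [this] at hk0
    exact zero_ne_one hk0
  have hKc : Continuous K := hK2.continuous
  have hKi : Integrable K := integrable_of_even_isBigO hKc hKev hKO
  have hk : ∀ t, kernelTransform K t = ∫ y, (K y : ℂ) * cexp (-((t * y : ℝ) : ℂ) * I) :=
    kernelTransform_eq_integral K
  have hK1 : ∫ y, K y = 1 := integral_eq_one_of_kernelTransform_zero hk0
  have hkc : Continuous (kernelTransform K) := InghamSmoothing.continuous_transform hKi hk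
  -- notation: index set `{½} ∪ P`, frequencies `w.im`, coefficients `a'`
  set P := (zetaZerosBelow_finite T).toFinset with hP
  set c₀ : ℂ := q 0 / (2 * riemannZeta (1 / 2)) with hc₀
  set a : ℂ → ℂ := fun ρ ↦ riemannZeta (2 * ρ) * q (ρ - 1 / 2) / deriv riemannZeta ρ with ha
  set a' : ℂ → ℂ := fun w ↦ if w = 1 / 2 then c₀ else a w with ha'
  set P' : Finset ℂ := insert (1 / 2) P with hP'
  have hhalf : (1 / 2 : ℂ) ∉ P := one_half_not_mem_zetaZerosBelow T
  have ha'P : ∀ ρ ∈ P, a' ρ = a ρ := by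
    intro ρ hρ
    have : ρ ≠ 1 / 2 := fun h ↦ hhalf (h ▸ hρ)
    simp only [ha']
    rw [if_neg this]
  set S : ℝ → ℂ := fun c ↦ ∑ w ∈ P', a' w * kernelTransform K (c * w.im) *
    cexp (((w.im * y₀ : ℝ) : ℂ) * I) with hS
  have hS1 : S 1 = zetaQuotInghamSum q (kernelTransform K) T y₀ := by
    simp only [hS, zetaQuotInghamSum, ← hP, one_mul]
    rw [Finset.sum_insert hhalf]
    have h1 : a' (1 / 2) = c₀ := by simp [ha']
    rw [h1]
    have him : ((1 / 2 : ℂ)).im = 0 := by simp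
    rw [him, hk0]
    simp only [Complex.ofReal_zero, zero_mul, Complex.ofReal_zero, Complex.exp_zero, mul_one]
    congr 1
    refine Finset.sum_congr rfl fun ρ hρ ↦ ?_
    rw [ha'P ρ hρ, show I * ((ρ.im : ℂ) * (y₀ : ℂ)) = ((ρ.im * y₀ : ℝ) : ℂ) * I by push_cast; ring]
    simp only [ha]
    ring
  have hSc : Tendsto S (𝓝[>] 1) (𝓝 (S 1)) := by
    refine Tendsto.mono_left (Continuous.tendsto ?_ 1) nhdsWithin_le_nhds
    refine continuous_finsetSum _ fun w _ ↦ ?_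
    exact (continuous_const.mul (hkc.comp (continuous_mul_const _))).mul continuous_const
  -- the abstract theorem for the dilated kernel, `c > 1`
  have key : ∀ c : ℝ, 1 < c → ∀ ε : ℝ, 0 < ε →
      (∃ᶠ y in atTop, (S c).re - ε < f y) ∧ (∃ᶠ y in atTop, f y < (S c).re + ε) := by
    intro c hc ε hε
    have hc0 : 0 < c := by linarith
    have hT' : T / c < T := by
      rw [div_lt_iff₀ hc0]; nlinarith
    obtain ⟨R, hRc, hRid⟩ := exists_regularPart_zetaQuot hq hzeros hT'
    have hKci : Integrable (fun y ↦ K (y / c) / c) := integrable_dilate hKi hc0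
    have hkc_eq : ∀ t, kernelTransform (fun y ↦ K (y / c) / c) t = kernelTransform K (c * t) :=
      kernelTransform_dilate hc0
    have hks : ∀ t, T / c ≤ |t| → kernelTransform (fun y ↦ K (y / c) / c) t = 0 := by
      intro t ht
      rw [hkc_eq]
      refine hkz _ ?_
      rw [abs_mul, abs_of_pos hc0]
      rwa [div_le_iff₀' hc0] at ht
    have hL' : ∀ A : ℝ, ((∀ u, f u ≤ A) ∨ (∀ u, -A ≤ f u)) →
        (∀ σ, 0 < σ → Integrable (fun u ↦ f u * Real.exp (-(σ * u)))) ∧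
        ∃ R : ℂ → ℂ, ContinuousOn R (Set.Icc 0 (1 / 4) ×ℂ Set.Icc (-(T / c)) (T / c)) ∧
          ∀ σ t : ℝ, 0 < σ → σ ≤ 1 / 4 → |t| ≤ T / c →
            ∫ u, (f u : ℂ) * cexp (-(((σ : ℂ) + t * I) * u)) =
              ∑ w ∈ P', a' w / ((σ : ℂ) + t * I - w.im * I) + R (σ + t * I) := by
      intro A hA
      obtain ⟨hint, hlap⟩ := hL A hA
      refine ⟨hint, R, hRc, fun σ t hσ hσ' ht ↦ ?_⟩
      rw [hlap σ t hσ (by linarith), hRid σ t hσ hσ' ht, Finset.sum_insert hhalf]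
      have h1 : a' (1 / 2) = c₀ := by simp [ha']
      have him : ((1 / 2 : ℂ)).im = 0 := by simp
      rw [h1, him]
      simp only [Complex.ofReal_zero, zero_mul, sub_zero]
      congr 2
      exact Finset.sum_congr rfl fun ρ hρ ↦ by rw [ha'P ρ hρ]
    have h := InghamSmoothing.frequently_gt_and_lt_of_laplace P' (fun w : ℂ ↦ w.im) a'
      (f := f) (K := fun y ↦ K (y / c) / c)
      (k := fun t ↦ kernelTransform (fun y ↦ K (y / c) / c) t) (σ₀ := 1 / 4) (T' := T / c)
      hfm hf0 hfloc
      ((hKc.comp (continuous_id.div_const c)).div_const c)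
      (fun v ↦ div_nonneg (hKnn _) hc0.le) hKci (by rw [integral_dilate hc0, hK1])
      (fun t ↦ kernelTransform_eq_integral _ t) hks (by norm_num) hL' y₀ hε
    have hsum : ∑ w ∈ P', a' w * kernelTransform (fun y ↦ K (y / c) / c) w.im *
        cexp (((w.im * y₀ : ℝ) : ℂ) * I) = S c := by
      simp only [hS]
      exact Finset.sum_congr rfl fun w _ ↦ by rw [hkc_eq]
    rw [hsum] at h
    exact h
  -- `c → 1⁺`
  have hclose : ∀ ε : ℝ, 0 < ε → ∃ c : ℝ, 1 < c ∧ |(S c).re - (S 1).re| < ε := by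
    intro ε hε
    have h1 : ∀ᶠ c in 𝓝[>] (1 : ℝ), dist (S c) (S 1) < ε := (Metric.tendsto_nhds.1 hSc) ε hε
    obtain ⟨c, hc, hc1⟩ := (h1.and self_mem_nhdsWithin).exists
    refine ⟨c, hc1, lt_of_le_of_lt ?_ hc⟩
    rw [← Complex.sub_re, dist_eq_norm]
    exact Complex.abs_re_le_norm _
  rw [← hS1]
  constructor
  · intro b hb
    obtain ⟨c, hc1, hc⟩ := hclose (((S 1).re - b) / 2) (by linarith)
    have h := (key c hc1 (((S 1).re - b) / 2) (by linarith)).1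
    refine h.mono fun y hy ↦ ?_
    have := (abs_lt.1 hc).1
    linarith
  · intro b hb
    obtain ⟨c, hc1, hc⟩ := hclose ((b - (S 1).re) / 2) (by linarith)
    have h := (key c hc1 ((b - (S 1).re) / 2) (by linarith)).2
    refine h.mono fun y hy ↦ ?_
    have := (abs_lt.1 hc).2
    linarith

end Literature.NumberTheory.LFunctions
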